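import Mathlib
import HarnessLib
import Summits.HubbardSuperconductivity.HubbardSuperconductivity.Theorems.KLProgrammeKLRegimeFatMultiplierIncrementSampled
import Summits.HubbardSuperconductivity.HubbardSuperconductivity.Theorems.KLProgrammeKLRegimeFatMultiplierPackThird

/-!
# Route `KLProgramme` — crux K3 ENGINE (stmt-HubbardSuperconductivity-20437) stub (b) conj. 2, cure «(c-D)² FAMILY TELESCOPE», brick (D2b-instance, SPACE):
# the fat multiplier INCREMENT pair `(F̃^{K′}_ω − F̃^{K}_ω)·F̃^{K}_{ω′}` as a sampled increment symbol — its first three SPACE differences along an integer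
# step, isotropic form, every term carrying a jet of the piece `ν = e_K − e_{K′}`

Cell `gate-hubbard-kl`, seat hubbard-kl-k3c3-p2 (g10); (R68c) EARLY-GO.  The increment pair's continuum symbol is
`Φ^Δ(k₀,p) = [G_{m₁}(k₀²+(e_K(p) − ν(p))²) − G_{m₁}(k₀²+e_K(p)²)] · (G_{m₁}(k₀²+e_K(p)²)·Z(p))` with p3's fat angular factor `Z` (`…FatAngularFactor`; square cutoffs
inside) — exactly the `I·Q` shape of the generic layer `…FatMultiplierIncrementSampled.norm_fwdDiff_iter_space_incrSymbol_le`.  This file feeds that layer with the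
frame band's line data (`τ_w = (4+2A)‖w‖`, `K₂ = 4+4A`, `K₃ = 4+8A₃`), the piece's line data (Fréchet sup-jets `N₀ … N₃` of `ν`), and the co-factor's localised
line data (single profile `G_{m₁}`: `g = (1, de₀², de₀⁴, de₀⁶)`, `scaleProfile_bounds₃`; angular sizes `z₁, z₂, z₃` of `abs_derivs3_fatAngular_line_le` inside the shell via
`fatPair_inner`; off the shell `|e_K| > Λ_{m₁}` the co-factor vanishes identically near the point).

* **`norm_fwdDiff_iter_space_fatIncrPair_le`** — for every `q` and integer step `u` (`3|2π/L||u_j| ≤ z`):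
  `‖Δ_{(0,ū)} Gs^Δ‖ ≤ 𝔅₁q₀ + 𝔅₀q₁`, `‖Δ²‖ ≤ 𝔅₂q₀ + 2𝔅₁q₁ + 𝔅₀q₂`, `‖Δ³‖ ≤ 𝔅₃q₀ + 3𝔅₂q₁ + 3𝔅₁q₂ + 𝔅₀q₃` with the 𝔅's of the generic layer at
  `(E₁,E₂,E₃) = (τ_w, K₂‖w‖², K₃‖w‖³)`, `(P₀..P₃) = (N₀, N₁‖w‖, N₂‖w‖², N₃‖w‖³)` and `q₀ = 1`, `q₁ = 2g₁τ_w/Λ + z₁`,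
  `q₂ = (4g₂+2g₁)τ_w²/Λ² + 2g₁K₂‖w‖²/Λ + 4g₁τ_w/Λ·z₁ + z₂`, `q₃ = [(8g₃+12g₂)τ_w³/Λ³ + (12g₂+6g₁)τ_wK₂‖w‖²/Λ² + 2g₁K₃‖w‖³/Λ] + 3[(4g₂+2g₁)τ_w²/Λ² + 2g₁K₂‖w‖²/Λ]z₁
  + 3(2g₁τ_w/Λ)z₂ + z₃` (the isotropic form; the anisotropic tangent form is the same call of the generic layer with `E₁ = τ_t`).

Everything is proved; no definitions, no sorry.  Nothing asserts superconductivity. [cite: BenfattoGiulianiMastropietro2006, §2.5 Lemma 2.2 (2.53)–(2.55), §2.7 (2.71a), §3 (3.2)–(3.8)]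
-/

noncomputable section

namespace Summit.HubbardSuperconductivity.HubbardSuperconductivity.Theorems.TorusFourierL2

set_option linter.dupNamespace false -- summit = problem name (single-conjunct summit), D-0017

open Set Finset Filter Topology Literature.MathematicalPhysics.QuantumLattice Literature.MathematicalPhysics.QuantumLattice.BandSectorCounting
open Literature.MathematicalPhysics.QuantumLattice.FermiRG Literature.Probability.LatticeModels Literature.Analysis.SpecialFunctions Literature.Analysis.Calculus
open Summit.HubbardSuperconductivity.HubbardSuperconductivity.Theorems.DispersionFlow
open Summit.HubbardSuperconductivity.HubbardSuperconductivity.Theorems.KLRegimeSplit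
open Summit.HubbardSuperconductivity.HubbardSuperconductivity.Theorems.KLProgrammeLegKernels
open Summit.HubbardSuperconductivity.HubbardSuperconductivity.Theorems.PerturbedFermiCurve
open scoped Real Nat

section FatIncrPair

variable {L M : ℕ} [NeZero L] [NeZero M] {K : TrigPolyC4v} {A A₃ : ℝ}
  (hA : ∀ p : Momentum, ∀ j ≤ 2, ‖iteratedFDeriv ℝ j (frameShift K) p‖ ≤ A) (hA3 : ∀ p : Momentum, ‖iteratedFDeriv ℝ 3 (frameShift K) p‖ ≤ A₃)
  {μ e₀ z β : ℝ} (he : 0 < e₀) (hz : 0 < z) (hz1 : z ≤ 1) (hgap : e₀ + A + z ^ 2 < -μ) (h3 : e₀ + A - μ ≤ 3)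
  (m₁ : ℕ) {n : ℕ} {S₁ S₂ : Finset ℕ} (hS₁ : S₁ ⊆ range (sectorCount n)) (hS₂ : S₂ ⊆ range (sectorCount n))
  {d : ℝ} (hd1 : ∀ u, |deriv (bgmCutoffSq e₀) u| ≤ d) (hd2 : ∀ u, |iteratedDeriv 2 (bgmCutoffSq e₀) u| ≤ d)
  (hd3 : ∀ u, |iteratedDeriv 3 (bgmCutoffSq e₀) u| ≤ d) (hd4 : ∀ u, |iteratedDeriv 4 (bgmCutoffSq e₀) u| ≤ d)
  {Ba : ℝ} (hB0 : 0 ≤ Ba)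
  (hB : ∀ (i : ℕ), i ≤ 3 → ∀ (n : ℕ) (ω : ℤ) (θ₀ : ℝ) (q w : Fin 2 → ℝ) (t : ℝ) {r₀ : ℝ}, 0 < r₀ →
    r₀ ≤ ‖momToComplex (q + t • w)‖ → |sectorRelAngle θ₀ (q + t • w)| < π →
    ‖iteratedDeriv i (fun t : ℝ => sectorWeightCirc n ω (polarAngle (q + t • w))) t‖ ≤
      (3 : ℕ)! * Ba * ((1 + (sectorWidth n)⁻¹ * (3 : ℕ)!) * ‖momToComplex w‖ / r₀) ^ i)
  {Z : (Fin 2 → ℝ) → ℝ}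
  (hZ : ∀ p, Z p = gnCutoff ((π + z) ^ 2 / π ^ 2) ((π + z) ^ 2) (p 0 ^ 2) * gnCutoff ((π + z) ^ 2 / π ^ 2) ((π + z) ^ 2) (p 1 ^ 2) *
    ((radialCutoffC (1 / 2) (momToComplex p) * ∑ a' ∈ S₁, sectorWeightCirc n ((a' : ℕ) : ℤ) (polarAngle p)) *
      (radialCutoffC (1 / 2) (momToComplex p) * ∑ b' ∈ S₂, sectorWeightCirc n ((b' : ℕ) : ℤ) (polarAngle p))))
  -- the piece `ν` (on `Fin 2 → ℝ`) with its sup-jets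
  {ν : (Fin 2 → ℝ) → ℝ} (hνs : ContDiff ℝ 3 ν) {N₀ N₁ N₂ N₃ : ℝ} (hN₀ : ∀ p, |ν p| ≤ N₀) (hN₁ : ∀ p, ‖fderiv ℝ ν p‖ ≤ N₁)
  (hN₂ : ∀ p, ‖iteratedFDeriv ℝ 2 ν p‖ ≤ N₂) (hN₃ : ∀ p, ‖iteratedFDeriv ℝ 3 ν p‖ ≤ N₃)
  -- the increment-pair symbol and its samples
  {Φ : ℝ × (Fin 2 → ℝ) → ℂ}
  (hΦ : ∀ k₀ p, Φ (k₀, p) = (((bgmCutoffSq e₀ ((16 : ℝ) ^ m₁ * (k₀ ^ 2 + (frameLevel μ K (WithLp.toLp 2 p) - ν p) ^ 2)) -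
      bgmCutoffSq e₀ ((16 : ℝ) ^ m₁ * (k₀ ^ 2 + frameLevel μ K (WithLp.toLp 2 p) ^ 2))) *
      (bgmCutoffSq e₀ ((16 : ℝ) ^ m₁ * (k₀ ^ 2 + frameLevel μ K (WithLp.toLp 2 p) ^ 2)) * Z p) : ℝ) : ℂ))
  {Gs : TorusSite 1 (2 * M) × TorusSite 2 L → ℂ}
  (hGsΦ : ∀ q, Gs q = Φ (π * (1 - 2 * M) / β + 2 * π / β * (((q.1 0).val : ℕ) : ℝ), fun j => 2 * π / L * (((q.2 j).valMinAbs : ℤ) : ℝ)))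

include hA hA3 he hz hz1 hgap h3 hS₁ hS₂ hd1 hd2 hd3 hd4 hB0 hB hZ hνs hN₀ hN₁ hN₂ hN₃ hΦ hGsΦ in
set_option maxHeartbeats 3000000 in
/-- **Space differences of the sampled fat increment pair, orders 1–3, isotropic form** (see the module docstring; constants as abbreviation hypotheses,
instantiate with `rfl`). [cite: BenfattoGiulianiMastropietro2006, §2.5 Lemma 2.2 (2.53)–(2.55), §2.7 (2.71a), §3 (3.2)] -/
theorem norm_fwdDiff_iter_space_fatIncrPair_le (u : Fin 2 → ℤ) (hu : ∀ j, 3 * |2 * π / L| * |(u j : ℝ)| ≤ z)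
    {w : Fin 2 → ℝ} (hw : w = fun j => 2 * π / L * (u j : ℝ))
    {τw E₂ E₃ P₀ P₁ P₂ P₃ zD z₁ z₂ z₃ q₀ q₁ q₂ q₃ E₀ C₁ C₂ C₃ C₄ D₁ D₂ D₃ W₀ W₁ W₂ W₃ B₀ B₁ B₂ B₃ : ℝ}
    (hτw : τw = (4 + 2 * A) * ‖w‖) (hE₂ : E₂ = (4 + 4 * A) * ‖w‖ ^ 2) (hE₃ : E₃ = (4 + 8 * A₃) * ‖w‖ ^ 3)
    (hP₀ : P₀ = N₀) (hP₁ : P₁ = N₁ * ‖w‖) (hP₂ : P₂ = N₂ * ‖w‖ ^ 2) (hP₃ : P₃ = N₃ * ‖w‖ ^ 3)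
    (hzD : zD = (1 + 6 * (sectorWidth n)⁻¹) * ‖momToComplex w‖) (hz₁ : z₁ = (S₁.card * S₂.card : ℝ) * (12 * Ba * zD))
    (hz₂ : z₂ = (S₁.card * S₂.card : ℝ) * ((12 * Ba + 72 * Ba ^ 2) * zD ^ 2)) (hz₃ : z₃ = (S₁.card * S₂.card : ℝ) * ((12 * Ba + 216 * Ba ^ 2) * zD ^ 3))
    (hq₀ : q₀ = 1) (hq₁ : q₁ = 2 * (d * e₀ ^ 2) * τw / klScale e₀ m₁ * 1 + 1 * z₁)
    (hq₂ : q₂ = ((4 * (d * e₀ ^ 4) + 2 * (d * e₀ ^ 2)) * τw ^ 2 / klScale e₀ m₁ ^ 2 + 2 * (d * e₀ ^ 2) * ((4 + 4 * A) * ‖w‖ ^ 2) / klScale e₀ m₁) * 1 +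
      4 * (d * e₀ ^ 2) * τw / klScale e₀ m₁ * z₁ + 1 * z₂)
    (hq₃ : q₃ = ((8 * (d * e₀ ^ 6) + 12 * (d * e₀ ^ 4)) * τw ^ 3 / klScale e₀ m₁ ^ 3 +
        (12 * (d * e₀ ^ 4) + 6 * (d * e₀ ^ 2)) * (τw * ((4 + 4 * A) * ‖w‖ ^ 2)) / klScale e₀ m₁ ^ 2 +
        2 * (d * e₀ ^ 2) * ((4 + 8 * A₃) * ‖w‖ ^ 3) / klScale e₀ m₁) * 1 +
      3 * (((4 * (d * e₀ ^ 4) + 2 * (d * e₀ ^ 2)) * τw ^ 2 / klScale e₀ m₁ ^ 2 + 2 * (d * e₀ ^ 2) * ((4 + 4 * A) * ‖w‖ ^ 2) / klScale e₀ m₁) * z₁) +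
      3 * (2 * (d * e₀ ^ 2) * τw / klScale e₀ m₁ * z₂) + 1 * z₃)
    (hE₀ : E₀ = klScale e₀ m₁ + P₀)
    (hC₁ : C₁ = d * e₀ ^ 2 / klScale e₀ m₁ ^ 2) (hC₂ : C₂ = d * e₀ ^ 4 / klScale e₀ m₁ ^ 4) (hC₃ : C₃ = d * e₀ ^ 6 / klScale e₀ m₁ ^ 6)
    (hC₄ : C₄ = d * e₀ ^ 8 / klScale e₀ m₁ ^ 8)
    (hD₁ : D₁ = 2 * E₀ * τw) (hD₂ : D₂ = 2 * (τw ^ 2 + E₀ * E₂)) (hD₃ : D₃ = 2 * (3 * τw * E₂ + E₀ * E₃))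
    (hW₀ : W₀ = P₀ * (2 * E₀ + P₀)) (hW₁ : W₁ = 2 * (τw * P₀ + E₀ * P₁ + P₀ * P₁))
    (hW₂ : W₂ = 2 * (E₂ * P₀ + 2 * τw * P₁ + E₀ * P₂ + P₁ ^ 2 + P₀ * P₂))
    (hW₃ : W₃ = 2 * (E₃ * P₀ + 3 * E₂ * P₁ + 3 * τw * P₂ + E₀ * P₃ + 3 * P₁ * P₂ + P₀ * P₃))
    (hB₀ : B₀ = C₁ * W₀) (hB₁ : B₁ = C₂ * W₀ * (D₁ + W₁) + C₁ * W₁)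
    (hB₂ : B₂ = C₃ * W₀ * (D₁ + W₁) ^ 2 + C₂ * (W₁ * (2 * D₁ + W₁)) + (C₂ * W₀ * (D₂ + W₂) + C₁ * W₂))
    (hB₃ : B₃ = C₄ * W₀ * (D₁ + W₁) ^ 3 + C₃ * (W₁ * (3 * D₁ ^ 2 + 3 * D₁ * W₁ + W₁ ^ 2)) +
        3 * (C₃ * W₀ * ((D₁ + W₁) * (D₂ + W₂)) + C₂ * (D₁ * W₂ + W₁ * D₂ + W₁ * W₂)) + (C₂ * W₀ * (D₃ + W₃) + C₁ * W₃))
    (q : TorusSite 1 (2 * M) × TorusSite 2 L) :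
    ‖(fwdDiff ((0 : TorusSite 1 (2 * M)), (fun j => ((u j : ℤ) : ZMod L)))) Gs q‖ ≤ B₁ * q₀ + B₀ * q₁ ∧
    ‖((fwdDiff ((0 : TorusSite 1 (2 * M)), (fun j => ((u j : ℤ) : ZMod L))))^[2] Gs) q‖ ≤ B₂ * q₀ + 2 * (B₁ * q₁) + B₀ * q₂ ∧
    ‖((fwdDiff ((0 : TorusSite 1 (2 * M)), (fun j => ((u j : ℤ) : ZMod L))))^[3] Gs) q‖ ≤ B₃ * q₀ + 3 * (B₂ * q₁) + 3 * (B₁ * q₂) + B₀ * q₃ := by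
  have hΛ : 0 < klScale e₀ m₁ := by rw [klScale]; positivity
  have hΛe : klScale e₀ m₁ ≤ e₀ := klScale_le_e0 he.le m₁
  have hL : (0 : ℝ) < L := Nat.cast_pos.2 (Nat.pos_of_ne_zero (NeZero.ne L))
  have hd0 : 0 ≤ d := (abs_nonneg _).trans (hd1 0)
  have hA0 : 0 ≤ A := (norm_nonneg _).trans (hA 0 0 (by norm_num))
  have hA30 : 0 ≤ A₃ := (norm_nonneg _).trans (hA3 0)
  have hN00 : 0 ≤ N₀ := (abs_nonneg _).trans (hN₀ 0)
  have hcard : (0 : ℝ) ≤ S₁.card * S₂.card := by positivity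
  -- the frame band and its line data
  set eK : (Fin 2 → ℝ) → ℝ := fun p => frameLevel μ K (WithLp.toLp 2 p) with heK
  have he3 : ContDiff ℝ 3 eK := contDiff_frameBand μ K
  have he2 : ContDiff ℝ 2 eK := contDiff_frameBand μ K
  have hK2f : ∀ p, ‖iteratedFDeriv ℝ 2 eK p‖ ≤ 4 + 4 * A := norm_iteratedFDeriv_two_frameBand_le hA μ
  have hK3f : ∀ p, ‖iteratedFDeriv ℝ 3 eK p‖ ≤ 4 + 8 * A₃ := norm_iteratedFDeriv_three_frameBand_le hA3 μ
  have hτ : ∀ p, |fderiv ℝ eK p w| ≤ τw := fun p => by rw [hτw]; exact abs_fderiv_frameBand_apply_le hA μ p w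
  have hτ0 : 0 ≤ τw := (abs_nonneg _).trans (hτ 0)
  have lE₁ : ∀ (p₀ : Fin 2 → ℝ) (s : ℝ), |deriv (fun s : ℝ => eK (p₀ + s • w)) s| ≤ τw := fun p₀ s => by
    rw [deriv_line_eq_fderiv he2 p₀ w s]; exact hτ _
  have lE₂ : ∀ (p₀ : Fin 2 → ℝ) (s : ℝ), |iteratedDeriv 2 (fun s : ℝ => eK (p₀ + s • w)) s| ≤ E₂ := fun p₀ s => by
    rw [hE₂]; exact abs_iteratedDeriv_two_line_le he2 hK2f p₀ w s
  have lE₃ : ∀ (p₀ : Fin 2 → ℝ) (s : ℝ), |iteratedDeriv 3 (fun s : ℝ => eK (p₀ + s • w)) s| ≤ E₃ := fun p₀ s => by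
    rw [hE₃]; exact abs_iteratedDeriv_three_line_le he3 hK3f p₀ w s
  -- the piece's line data
  have hν2 : ContDiff ℝ 2 ν := hνs.of_le (by norm_num)
  have lP₀ : ∀ p, |ν p| ≤ P₀ := fun p => by rw [hP₀]; exact hN₀ p
  have lP₁ : ∀ (p₀ : Fin 2 → ℝ) (s : ℝ), |deriv (fun s : ℝ => ν (p₀ + s • w)) s| ≤ P₁ := fun p₀ s => by
    rw [deriv_line_eq_fderiv hν2 p₀ w s, hP₁, ← Real.norm_eq_abs]
    exact (ContinuousLinearMap.le_opNorm _ _).trans (mul_le_mul_of_nonneg_right (hN₁ _) (norm_nonneg _))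
  have lP₂ : ∀ (p₀ : Fin 2 → ℝ) (s : ℝ), |iteratedDeriv 2 (fun s : ℝ => ν (p₀ + s • w)) s| ≤ P₂ := fun p₀ s => by
    rw [hP₂]; exact abs_iteratedDeriv_two_line_le hν2 hN₂ p₀ w s
  have lP₃ : ∀ (p₀ : Fin 2 → ℝ) (s : ℝ), |iteratedDeriv 3 (fun s : ℝ => ν (p₀ + s • w)) s| ≤ P₃ := fun p₀ s => by
    rw [hP₃]; exact abs_iteratedDeriv_three_line_le hνs hN₃ p₀ w s
  -- the single profile and the angular factor
  set G : ℝ → ℝ := fun v => bgmCutoffSq e₀ ((16 : ℝ) ^ m₁ * v) with hGdef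
  obtain ⟨hGc, hG0, hG1, hG2, hG3, hGv⟩ := scaleProfile_bounds₃ he m₁ hd1 hd2 hd3
  have hZc : ContDiff ℝ 3 Z := by rw [show Z = _ from funext hZ]; exact contDiff_fatAngularFormula z n S₁ S₂
  have hZ0 : ∀ p, |Z p| ≤ 1 := abs_fatAngular_le_one hZ hS₁ hS₂
  have hzD0 : 0 ≤ zD := by rw [hzD]; have := sectorWidth_pos n; positivity
  have hz₁0 : 0 ≤ z₁ := by rw [hz₁]; positivity
  have hz₂0 : 0 ≤ z₂ := by rw [hz₂]; positivity
  have hz₃0 : 0 ≤ z₃ := by rw [hz₃]; positivity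
  have hq₀0 : 0 ≤ q₀ := by rw [hq₀]; norm_num
  have hq₁0 : 0 ≤ q₁ := by rw [hq₁]; positivity
  have hq₂0 : 0 ≤ q₂ := by rw [hq₂]; positivity
  have hq₃0 : 0 ≤ q₃ := by rw [hq₃]; positivity
  -- the co-factor `Q(k₀, p) = G(k₀² + e_K(p)²)·Z(p)` along space lines
  set Q : ℝ × (Fin 2 → ℝ) → ℝ := fun kp => G (kp.1 ^ 2 + eK kp.2 ^ 2) * Z kp.2 with hQdef
  have hQline : ∀ (k₀ : ℝ) (p₀ : Fin 2 → ℝ), (fun s : ℝ => Q (k₀, p₀ + s • w)) = fun s => G (eK (p₀ + s • w) ^ 2 + k₀ ^ 2) * Z (p₀ + s • w) := by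
    intro k₀ p₀; funext s; simp only [hQdef]; rw [add_comm (k₀ ^ 2)]
  have hQC : ∀ (k₀ : ℝ) (p₀ : Fin 2 → ℝ), ContDiff ℝ 3 (fun s : ℝ => Q (k₀, p₀ + s • w)) := by
    intro k₀ p₀; rw [hQline]
    exact (hGc.comp (((he3.comp (contDiff_const.add (contDiff_id.smul contDiff_const))).pow 2).add contDiff_const)).mul
      (hZc.comp (contDiff_const.add (contDiff_id.smul contDiff_const)))
  have hQ0 : ∀ k₀ p, |Q (k₀, p)| ≤ q₀ := fun k₀ p => by
    simp only [hQdef]; rw [abs_mul, hq₀]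
    calc |G (k₀ ^ 2 + eK p ^ 2)| * |Z p| ≤ 1 * 1 := mul_le_mul (hG0 _) (hZ0 p) (abs_nonneg _) zero_le_one
      _ = 1 := one_mul _
  -- localised line bounds of the co-factor: inside the shell `|e_K| ≤ Λ_{m₁}` by the symbol layer, outside by vanishing
  have hsplit : ∀ (k₀ : ℝ) (p₀ : Fin 2 → ℝ) (s : ℝ), (∀ i, |(p₀ + s • w) i| ≤ π + z) →
      (|eK (p₀ + s • w)| ≤ klScale e₀ m₁ →
        |deriv (fun s : ℝ => Q (k₀, p₀ + s • w)) s| ≤ q₁ ∧ |iteratedDeriv 2 (fun s : ℝ => Q (k₀, p₀ + s • w)) s| ≤ q₂ ∧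
          |iteratedDeriv 3 (fun s : ℝ => Q (k₀, p₀ + s • w)) s| ≤ q₃) ∧
      (klScale e₀ m₁ < |eK (p₀ + s • w)| → ∀ j, 1 ≤ j → iteratedDeriv j (fun s : ℝ => Q (k₀, p₀ + s • w)) s = 0) := by
    intro k₀ p₀ s hsq
    refine ⟨fun hshell => ?_, fun hfar j hj => ?_⟩
    · obtain ⟨hin, hfermi⟩ := fatPair_inner hA he hz hz1 hgap h3 (m₁ := m₁) _ hsq hshell
      obtain ⟨hZ1s, hZ2s, hZ3s⟩ := abs_derivs3_fatAngular_line_le hZ hz hB0 hB p₀ w hin hfermi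
      rw [← hzD] at hZ1s hZ2s hZ3s; rw [← hz₁] at hZ1s; rw [← hz₂] at hZ2s; rw [← hz₃] at hZ3s
      have hZl : ContDiff ℝ 3 fun σ : ℝ => Z (p₀ + σ • w) := hZc.comp (contDiff_const.add (contDiff_id.smul contDiff_const))
      have hZl2 : ContDiff ℝ 2 fun σ : ℝ => Z (p₀ + σ • w) := hZl.of_le (by norm_num)
      have hGc2 : ContDiff ℝ 2 G := hGc.of_le (by norm_num)
      have hZ0s : |Z (p₀ + s • w)| ≤ 1 := hZ0 _
      have hdir : |fderiv ℝ eK (p₀ + s • w) w| ≤ τw := hτ _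
      have hdir0 := abs_nonneg (fderiv ℝ eK (p₀ + s • w) w)
      rw [hQline]
      refine ⟨?_, ?_, ?_⟩
      · have h := abs_deriv_symbol_spaceLine_le he2 hGc2 hZl2 hΛ (by positivity) hG0 hG1 hGv (sq_nonneg k₀) p₀ w s
        refine h.trans ?_
        rw [hq₁]
        gcongr
      · have h := abs_iteratedDeriv_two_symbol_spaceLine_le he2 hK2f hGc2 hZl2 hΛ (by positivity) (by positivity) hG0 hG1 hG2 hGv (sq_nonneg k₀) p₀ w s
        refine h.trans ?_
        rw [hq₂]
        have hsq2 : (fderiv ℝ eK (p₀ + s • w) w) ^ 2 ≤ τw ^ 2 := by rw [← sq_abs]; exact pow_le_pow_left₀ hdir0 hdir 2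
        gcongr
      · have h := abs_iteratedDeriv_three_symbol_spaceLine_le he3 hK2f hK3f hGc hZl hΛ (by positivity) (by positivity) (by positivity) hG0 hG1 hG2 hG3 hGv
          (sq_nonneg k₀) p₀ w s
        refine h.trans ?_
        rw [hq₃]
        have hsq2 : (fderiv ℝ eK (p₀ + s • w) w) ^ 2 ≤ τw ^ 2 := by rw [← sq_abs]; exact pow_le_pow_left₀ hdir0 hdir 2
        have hcu : |fderiv ℝ eK (p₀ + s • w) w| ^ 3 ≤ τw ^ 3 := pow_le_pow_left₀ hdir0 hdir 3
        gcongr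
    · -- off the shell the plain profile factor vanishes identically near `s`
      have hcont : Continuous fun σ : ℝ => eK (p₀ + σ • w) := (he3.continuous).comp (by fun_prop)
      have hopen : ∀ᶠ σ in 𝓝 s, klScale e₀ m₁ < |eK (p₀ + σ • w)| :=
        (continuous_abs.comp hcont).continuousAt.eventually (lt_mem_nhds hfar)
      have hev : (fun σ : ℝ => Q (k₀, p₀ + σ • w)) =ᶠ[𝓝 s] fun _ => (0 : ℝ) := by
        filter_upwards [hopen] with σ hσ
        have hbig : klScale e₀ m₁ ^ 2 < k₀ ^ 2 + eK (p₀ + σ • w) ^ 2 := by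
          have := sq_lt_sq' (by linarith [abs_nonneg (eK (p₀ + σ • w))]) hσ
          rw [sq_abs] at this; nlinarith [sq_nonneg k₀]
        simp only [hQdef, hGdef]
        rw [hGv _ hbig, zero_mul]
      rw [(hev.iteratedDeriv j).eq_of_nhds, iteratedDeriv_const]
      simp [show j ≠ 0 by omega]
  have hQ1 : ∀ (k₀ : ℝ) (p₀ : Fin 2 → ℝ) (s : ℝ), (∀ i, |(p₀ + s • w) i| ≤ π + z) → |eK (p₀ + s • w)| ≤ klScale e₀ m₁ + P₀ →
      |deriv (fun s : ℝ => Q (k₀, p₀ + s • w)) s| ≤ q₁ := by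
    intro k₀ p₀ s hsq _
    rcases le_or_gt |eK (p₀ + s • w)| (klScale e₀ m₁) with h | h
    · exact ((hsplit k₀ p₀ s hsq).1 h).1
    · have h0 := (hsplit k₀ p₀ s hsq).2 h 1 le_rfl
      rw [iteratedDeriv_one] at h0; rw [h0, abs_zero]; exact hq₁0
  have hQ2 : ∀ (k₀ : ℝ) (p₀ : Fin 2 → ℝ) (s : ℝ), (∀ i, |(p₀ + s • w) i| ≤ π + z) → |eK (p₀ + s • w)| ≤ klScale e₀ m₁ + P₀ →
      |iteratedDeriv 2 (fun s : ℝ => Q (k₀, p₀ + s • w)) s| ≤ q₂ := by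
    intro k₀ p₀ s hsq _
    rcases le_or_gt |eK (p₀ + s • w)| (klScale e₀ m₁) with h | h
    · exact ((hsplit k₀ p₀ s hsq).1 h).2.1
    · rw [(hsplit k₀ p₀ s hsq).2 h 2 (by norm_num), abs_zero]; exact hq₂0
  have hQ3 : ∀ (k₀ : ℝ) (p₀ : Fin 2 → ℝ) (s : ℝ), (∀ i, |(p₀ + s • w) i| ≤ π + z) → |eK (p₀ + s • w)| ≤ klScale e₀ m₁ + P₀ →
      |iteratedDeriv 3 (fun s : ℝ => Q (k₀, p₀ + s • w)) s| ≤ q₃ := by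
    intro k₀ p₀ s hsq _
    rcases le_or_gt |eK (p₀ + s • w)| (klScale e₀ m₁) with h | h
    · exact ((hsplit k₀ p₀ s hsq).1 h).2.2
    · rw [(hsplit k₀ p₀ s hsq).2 h 3 (by norm_num), abs_zero]; exact hq₃0
  -- the symbol in the generic `I·Q` form, the zone, the sampling step
  have hΦ' : ∀ k₀ p, Φ (k₀, p) = (((bgmCutoffSq e₀ ((16 : ℝ) ^ m₁ * (k₀ ^ 2 + (eK p - ν p) ^ 2)) -
      bgmCutoffSq e₀ ((16 : ℝ) ^ m₁ * (k₀ ^ 2 + eK p ^ 2))) * Q (k₀, p) : ℝ) : ℂ) := fun k₀ p => by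
    simp only [hΦ, hQdef, hGdef, heK]
  have hzoneΦ : ∀ (k₀ : ℝ) (p : Fin 2 → ℝ), (∃ j, π - z ≤ |p j|) → Φ (k₀, p) = 0 := by
    intro k₀ p hp
    have h0 := fatPair_profile_mul_angular_eq_zero (m₁ := m₁) hA he hz hz1 hgap hZ k₀ p hp
    rw [hΦ', show Q (k₀, p) = bgmCutoffSq e₀ ((16 : ℝ) ^ m₁ * (k₀ ^ 2 + frameLevel μ K (WithLp.toLp 2 p) ^ 2)) * Z p by
      simp only [hQdef, hGdef, heK], h0, mul_zero, Complex.ofReal_zero]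
  have hxL : |2 * π / (L : ℝ)| * L = 2 * π := by rw [abs_of_pos (by positivity)]; field_simp
  have hu' : ∀ j, 3 * |2 * π / (L : ℝ)| * |(u j : ℝ)| ≤ z := hu
  exact norm_fwdDiff_iter_space_incrSymbol_le (M := M) he m₁ hd1 hd2 hd3 hd4 he3 hνs w lE₁ lE₂ lE₃ lP₀ lP₁ lP₂ lP₃ Q hQC hq₀0 hq₁0 hq₂0 hq₃0 hQ0
    hQ1 hQ2 hQ3 Φ hΦ' (π * (1 - 2 * M) / β) (2 * π / β) (2 * π / L) u hw hu' hzoneΦ hxL Gs hGsΦ hE₀ hC₁ hC₂ hC₃ hC₄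
    (by rw [hD₁]) (by rw [hD₂]) (by rw [hD₃]) hW₀ (by rw [hW₁]) (by rw [hW₂]) (by rw [hW₃]) hB₀ hB₁ hB₂ hB₃ q

end FatIncrPair

end Summit.HubbardSuperconductivity.HubbardSuperconductivity.Theorems.TorusFourierL2

end
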